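import Literature.Geometry.Riemannian.RelativeL2HarmonicOneForms
import Literature.Geometry.Lorentzian.ConnectionNaturality
import Literature.Geometry.Lorentzian.InitialDataPullback
import HarnessLib

/-!
# Pullback of `1`-forms along smooth maps: smoothness and naturality of the covariant derivative

Support file (all results proved) for transporting the finiteness theorem for `L²` harmonic
`1`-forms (`Literature.Geometry.Riemannian.module_finite_l2HarmonicOneForms`, Carron's memoir,
Thm. 4.3) along isometries to manifolds over arbitrary real models. For a smooth map `Φ : N → M`
and a `1`-form `α` on `M`, the pulled-back form is `(Φ^*α)_u = α_{Φ u} ∘ dΦ_u`. We prove: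

* `contMDiffAt_oneFormSection_pullback` — **the pullback of a `C^∞` `1`-form along a `C^∞` map
  is a `C^∞` `1`-form** (in the trivialisations of the cotangent bundles the section reads
  `u ↦ α̂(Φ u) ∘ D̂Φ(u)`, the product of the coordinate expression of `α`, smooth by hypothesis,
  and of `dΦ` in tangent coordinates, smooth by Mathlib's `ContMDiffAt.mfderiv_const`);
* `covDerivOneForm_pullback_apply` — **naturality of the covariant derivative of `1`-forms under
  equidimensional immersions**: for the pullback metric `Φ^*g`,
  `(∇^{Φ^*g} (Φ^*α))_u (Y₀, Z₀) = (∇^g α)_{Φ u} (dΦ_u Y₀, dΦ_u Z₀)` (O'Neill 1983, Ch. 3,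
  Prop. 3.59: isometries preserve the Levi-Civita connection and hence all its tensor
  derivations; here from `leviCivita_comap_mpullback_apply` of `ConnectionNaturality.lean`).

Everything is proved; no definitions, no named facts (D-0026).

## References

* B. O'Neill, *Semi-Riemannian geometry*, Academic Press 1983, Ch. 3, Def. 3.16–3.17,
  Prop. 3.59. [`ONeill1983`]
-/

noncomputable section

open Bundle Set Function Filter FiberBundle VectorField
open scoped Manifold ContDiff Topology

namespace Literature.Geometry.Riemannian

open Literature.Geometry.Lorentzian

variable {E : Type*} [NormedAddCommGroup E] [NormedSpace ℝ E] {H : Type*} [TopologicalSpace H]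
  {I : ModelWithCorners ℝ E H} {M : Type*} [TopologicalSpace M] [ChartedSpace H M]
  [IsManifold I ∞ M]
  {E' : Type*} [NormedAddCommGroup E'] [NormedSpace ℝ E'] {H' : Type*} [TopologicalSpace H']
  {I' : ModelWithCorners ℝ E' H'} {N : Type*} [TopologicalSpace N] [ChartedSpace H' N]
  [IsManifold I' ∞ N]

/-! ### Smoothness of the pullback -/

set_option backward.isDefEq.respectTransparency false in
/-- **The pullback of a smooth `1`-form along a smooth map is smooth.** If `Φ : N → M` is `C^∞`
at `u₀` and the `1`-form `α` is a `C^∞` section of `T*M` at `Φ u₀`, then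
`u ↦ α_{Φ u} ∘ dΦ_u` is a `C^∞` section of `T*N` at `u₀`: in the trivialisations at `u₀` and
`Φ u₀` it reads `u ↦ α̂(Φ u) ∘ D̂Φ(u)` with `α̂` the (smooth) coordinate expression of `α` and
`D̂Φ = inTangentCoordinates I' I id Φ dΦ u₀` (smooth by `ContMDiffAt.mfderiv_const`).
O'Neill 1983, Ch. 3, Prop. 3.59 ff. (pullback of tensors). [folklore] -/
theorem contMDiffAt_oneFormSection_pullback {Φ : N → M} {u₀ : N}
    (hΦ : ContMDiffAt I' I ∞ Φ u₀) {α : Π x : M, TangentSpace I x →L[ℝ] ℝ}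
    (hα : ContMDiffAt I (I.prod 𝓘(ℝ, E →L[ℝ] ℝ)) ∞ (oneFormSection α) (Φ u₀)) :
    ContMDiffAt I' (I'.prod 𝓘(ℝ, E' →L[ℝ] ℝ)) ∞
      (oneFormSection fun u ↦ (α (Φ u)).comp (mfderiv I' I Φ u)) u₀ := by
  set eM := trivializationAt E (TangentSpace I) (Φ u₀) with heM
  set eN := trivializationAt E' (TangentSpace I') u₀ with heN
  -- the coordinate expression of `α` near `Φ u₀`
  rw [contMDiffAt_hom_bundle] at hα
  obtain ⟨-, hA⟩ := hα
  -- the trivialisations of the trivial line bundles are the identity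
  have htM : ∀ x, (trivializationAt ℝ (Bundle.Trivial M ℝ) (Φ u₀)).continuousLinearMapAt ℝ x =
      ContinuousLinearMap.id ℝ ℝ := fun x ↦ Bundle.Trivial.continuousLinearMapAt_trivialization ℝ M ℝ x
  have htN : ∀ u, (trivializationAt ℝ (Bundle.Trivial N ℝ) u₀).continuousLinearMapAt ℝ u =
      ContinuousLinearMap.id ℝ ℝ := fun u ↦ Bundle.Trivial.continuousLinearMapAt_trivialization ℝ N ℝ u
  -- the coordinate expression of `dΦ`
  have hD := hΦ.mfderiv_const (m := ∞) le_rfl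
  -- the claimed coordinate expression of the pullback
  have hcomp : ContMDiffAt I' 𝓘(ℝ, E' →L[ℝ] ℝ) ∞ (fun u ↦
      (ContinuousLinearMap.inCoordinates E (TangentSpace I) ℝ (Bundle.Trivial M ℝ)
        (Φ u₀) (Φ u) (Φ u₀) (Φ u) (α (Φ u))).comp
      (inTangentCoordinates I' I id Φ (mfderiv I' I Φ) u₀ u)) u₀ :=
    (hA.comp u₀ hΦ).clm_comp hD
  rw [contMDiffAt_hom_bundle]
  refine ⟨contMDiffAt_id, hcomp.congr_of_eventuallyEq ?_⟩
  -- the two coordinate expressions agree near `u₀`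
  have h1 : ∀ᶠ u in 𝓝 u₀, Φ u ∈ eM.baseSet :=
    hΦ.continuousAt.preimage_mem_nhds (eM.open_baseSet.mem_nhds
      (by simp [heM]))
  filter_upwards [h1] with u hu
  simp only [ContinuousLinearMap.inCoordinates, inTangentCoordinates, id]
  ext v
  simp only [ContinuousLinearMap.coe_comp, Function.comp_apply]
  rw [Trivialization.symmL_continuousLinearMapAt _ hu, htM (Φ u), htN u]

/-! ### Naturality of the covariant derivative of `1`-forms -/

section Naturality

variable [FiniteDimensional ℝ E] [FiniteDimensional ℝ E']
  (g : PseudoRiemannianMetric I ∞ E (TangentSpace I : M → Type _))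
  {Φ : N → M} (hpb : PseudoRiemannianMetric.contMDiff_pullbackBilin I M I' N ∞)
  (hΦ : ContMDiff I' I (∞ + 1) Φ) (hΦ' : ∀ u, Function.Injective (mfderiv I' I Φ u))
  (hdim : Module.finrank ℝ E' = Module.finrank ℝ E)

include hΦ' in
/-- **Naturality of `∇α` under equidimensional immersions.** For a smooth equidimensional
immersion `Φ : N → M`, the pullback metric `Φ^*g` and a `1`-form `α` smooth at `Φ u`,
`(∇^{Φ^*g} (Φ^*α))_u (Y₀, Z₀) = (∇^g α)_{Φ u} (dΦ_u Y₀, dΦ_u Z₀)`, `(Φ^*α)_u = α_{Φ u} ∘ dΦ_u`.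
Proof: evaluate `∇(Φ^*α)` on the pulled-back field `Φ^*W` (`W` an extension of `dΦ_u Y₀`):
`(Φ^*α)(Φ^*W) = α(W) ∘ Φ` (chain rule for the derivative term) and
`∇^{Φ^*g}_{Z₀} (Φ^*W) = dΦ⁻¹ ∇^g_{dΦ Z₀} W` (`leviCivita_comap_mpullback_apply`).
O'Neill 1983, Ch. 3, Prop. 3.59 (isometries preserve the connection and its tensor
derivations). [cite: ONeill1983, Ch. 3, Prop. 3.59] -/
theorem covDerivOneForm_pullback_apply [g.HasLeviCivita]
    [(g.comap hpb Φ hΦ hΦ' hdim).HasLeviCivita] {α : Π x : M, TangentSpace I x →L[ℝ] ℝ} {u : N}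
    (hα : ContMDiffAt I (I.prod 𝓘(ℝ, E →L[ℝ] ℝ)) ∞ (oneFormSection α) (Φ u))
    (Y₀ Z₀ : TangentSpace I' u) :
    (g.comap hpb Φ hΦ hΦ' hdim).covDerivOneForm (fun u ↦ (α (Φ u)).comp (mfderiv I' I Φ u)) u
        Y₀ Z₀ =
      g.covDerivOneForm α (Φ u) (mfderiv I' I Φ u Y₀) (mfderiv I' I Φ u Z₀) := by
  set g' := g.comap hpb Φ hΦ hΦ' hdim with hg'
  set β : Π u : N, TangentSpace I' u →L[ℝ] ℝ := fun u ↦ (α (Φ u)).comp (mfderiv I' I Φ u)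
    with hβ
  have hΦu : ContMDiffAt I' I ∞ Φ u := (hΦ u).of_le le_self_add
  have hΦd : MDifferentiableAt I' I Φ u := hΦu.mdifferentiableAt (by simp)
  have hinv : (mfderiv I' I Φ u).IsInvertible :=
    PseudoRiemannianMetric.isInvertible_mfderiv_of_injective hdim (hΦ' u)
  -- smoothness of the pulled-back form
  have hβs : ContMDiffAt I' (I'.prod 𝓘(ℝ, E' →L[ℝ] ℝ)) ∞ (oneFormSection β) u :=
    contMDiffAt_oneFormSection_pullback hΦu hα
  have hβd : MDifferentiableAt I' (I'.prod 𝓘(ℝ, E' →L[ℝ] ℝ)) (oneFormSection β) u :=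
    hβs.mdifferentiableAt (by simp)
  have hαd : MDifferentiableAt I (I.prod 𝓘(ℝ, E →L[ℝ] ℝ)) (oneFormSection α) (Φ u) :=
    hα.mdifferentiableAt (by simp)
  -- the fields: `W` extends `dΦ Y₀` on `M`, `Ỹ = Φ^* W` extends `Y₀`, `V` extends `dΦ Z₀`
  set W : Π x : M, TangentSpace I x := FiberBundle.extend E (mfderiv I' I Φ u Y₀) with hW
  have hWd : MDiffAt (T% W) (Φ u) := mdifferentiableAt_extend I E _
  have hWu : W (Φ u) = mfderiv I' I Φ u Y₀ := FiberBundle.extend_apply_self _ _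
  set Yt : Π u : N, TangentSpace I' u := mpullback I' I Φ W with hYt
  have hYtu : Yt u = Y₀ := PseudoRiemannianMetric.mpullback_extend_mfderiv_apply hΦ' hdim u Y₀
  have h1 : (1 : ℕ∞ω) ≤ ∞ := by exact_mod_cast (le_top : (1 : ℕ∞) ≤ ⊤)
  have h2 : (2 : ℕ∞ω) ≤ ∞ + 1 := by
    calc (2 : ℕ∞ω) = 1 + 1 := by norm_num
      _ ≤ ∞ + 1 := add_le_add h1 le_rfl
  have hYtd : MDiffAt (T% Yt) u := hWd.mpullback_vectorField (hΦ u) hinv h2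
  set Zf : Π u : N, TangentSpace I' u := FiberBundle.extend E' Z₀ with hZf
  have hZfu : Zf u = Z₀ := FiberBundle.extend_apply_self _ _
  set V : Π x : M, TangentSpace I x := FiberBundle.extend E (mfderiv I' I Φ u Z₀) with hV
  have hVu : V (Φ u) = mfderiv I' I Φ u Z₀ := FiberBundle.extend_apply_self _ _
  -- `(Φ^*α)(Φ^*W) = α(W) ∘ Φ`
  have hpair : (fun y ↦ β y (Yt y)) = (fun x ↦ α x (W x)) ∘ Φ := by
    funext y
    simp only [hβ, hYt, Function.comp_apply, ContinuousLinearMap.coe_comp]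
    rw [PseudoRiemannianMetric.mfderiv_mpullback_apply hΦ' hdim W y]
  have hfd : MDiffAt (fun x ↦ α x (W x)) (Φ u) := mdifferentiableAt_oneForm_apply hαd hWd
  -- left-hand side
  have hL : g'.covDerivOneForm β u Y₀ Z₀ =
      mvfderiv I (fun x ↦ α x (W x)) (Φ u) (mfderiv I' I Φ u Z₀) -
        α (Φ u) (g.leviCivita W (Φ u) (mfderiv I' I Φ u Z₀)) := by
    have h1 := covDerivOneForm_apply (g := g') hβd hYtd Zf
    rw [hYtu, hZfu] at h1
    rw [h1, PseudoRiemannianMetric.covDerivOneFormAux, hpair,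
      PseudoRiemannianMetric.mvfderiv_comp_apply hfd hΦd, hZfu,
      PseudoRiemannianMetric.leviCivita_comap_mpullback_apply g hpb hΦ hΦ' hdim hWd Z₀]
    simp only [hβ, ContinuousLinearMap.coe_comp, Function.comp_apply]
    rw [hinv.self_apply_inverse]
  -- right-hand side
  have hR : g.covDerivOneForm α (Φ u) (mfderiv I' I Φ u Y₀) (mfderiv I' I Φ u Z₀) =
      mvfderiv I (fun x ↦ α x (W x)) (Φ u) (mfderiv I' I Φ u Z₀) -
        α (Φ u) (g.leviCivita W (Φ u) (mfderiv I' I Φ u Z₀)) := by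
    have h1 := covDerivOneForm_apply (g := g) hαd hWd V
    rw [hWu, hVu] at h1
    rw [h1, PseudoRiemannianMetric.covDerivOneFormAux, hVu]
  rw [hL, hR]

include hΦ' in
/-- The covariant derivative of the pulled-back form is the pullback of the covariant derivative,
as bilinear forms: `(∇^{Φ^*g} (Φ^*α))_u = (∇^g α)_{Φ u} ∘ (dΦ_u × dΦ_u)`.
[cite: ONeill1983, Ch. 3, Prop. 3.59] -/
theorem covDerivOneForm_pullback [g.HasLeviCivita]
    [(g.comap hpb Φ hΦ hΦ' hdim).HasLeviCivita] {α : Π x : M, TangentSpace I x →L[ℝ] ℝ} {u : N}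
    (hα : ContMDiffAt I (I.prod 𝓘(ℝ, E →L[ℝ] ℝ)) ∞ (oneFormSection α) (Φ u)) :
    (g.comap hpb Φ hΦ hΦ' hdim).covDerivOneForm (fun u ↦ (α (Φ u)).comp (mfderiv I' I Φ u)) u =
      (g.covDerivOneForm α (Φ u)).comp (mfderiv I' I Φ u).toLinearMap
        (mfderiv I' I Φ u).toLinearMap :=
  LinearMap.ext₂ fun Y₀ Z₀ ↦ covDerivOneForm_pullback_apply g hpb hΦ hΦ' hdim hα Y₀ Z₀

include hΦ' in
/-- **Closedness transports**: if `∇^g α` is symmetric at `Φ u` then `∇^{Φ^*g}(Φ^*α)` is symmetric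
at `u`. [cite: ONeill1983, Ch. 3, Prop. 3.59] -/
theorem isSymm_covDerivOneForm_pullback [g.HasLeviCivita]
    [(g.comap hpb Φ hΦ hΦ' hdim).HasLeviCivita] {α : Π x : M, TangentSpace I x →L[ℝ] ℝ} {u : N}
    (hα : ContMDiffAt I (I.prod 𝓘(ℝ, E →L[ℝ] ℝ)) ∞ (oneFormSection α) (Φ u))
    (hsymm : (g.covDerivOneForm α (Φ u)).IsSymm) :
    ((g.comap hpb Φ hΦ hΦ' hdim).covDerivOneForm
      (fun u ↦ (α (Φ u)).comp (mfderiv I' I Φ u)) u).IsSymm := by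
  refine ⟨fun Y₀ Z₀ ↦ ?_⟩
  rw [covDerivOneForm_pullback_apply g hpb hΦ hΦ' hdim hα,
    covDerivOneForm_pullback_apply g hpb hΦ hΦ' hdim hα]
  exact hsymm.eq _ _

include hΦ' in
/-- **The divergence transports**: `tr_{Φ^*g} ∇^{Φ^*g}(Φ^*α) (u) = tr_g ∇^g α (Φ u)`
(`covDerivOneForm_pullback` and the naturality of the metric trace, `trace_comap`).
[cite: ONeill1983, Ch. 3, Prop. 3.59] -/
theorem trace_covDerivOneForm_pullback [g.HasLeviCivita]
    [(g.comap hpb Φ hΦ hΦ' hdim).HasLeviCivita] {α : Π x : M, TangentSpace I x →L[ℝ] ℝ} {u : N}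
    (hα : ContMDiffAt I (I.prod 𝓘(ℝ, E →L[ℝ] ℝ)) ∞ (oneFormSection α) (Φ u)) :
    (g.comap hpb Φ hΦ hΦ' hdim).trace u ((g.comap hpb Φ hΦ hΦ' hdim).covDerivOneForm
        (fun u ↦ (α (Φ u)).comp (mfderiv I' I Φ u)) u) =
      g.trace (Φ u) (g.covDerivOneForm α (Φ u)) := by
  have he : (mfderivEquivOfInjective (I := I) (I' := I') Φ u (hΦ' u) hdim).toLinearMap =
      (mfderiv I' I Φ u).toLinearMap := LinearMap.ext fun v ↦ rfl
  rw [covDerivOneForm_pullback g hpb hΦ hΦ' hdim hα, ← he]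
  exact PseudoRiemannianMetric.trace_comap g hpb hΦ hΦ' hdim u _

end Naturality

end Literature.Geometry.Riemannian

end
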